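import Mathlib

/-!
# Final arithmetic of the word-length lower bound (`stub_arith`)

The word has at least `n · (n / b)` disjoint variable blocks, each forcing more than
`2b · n^(2+ε)` letters, so `n · (n / b) · (2b · n^(2+ε)) ≤ L`.  Since `2b ≤ n` and `0 < b`
give `n ≤ (n / b) · (2b)` (natural-number division loses less than `b ≤ n / 2`), we get
`n^(4+ε) = n · n · n^(2+ε) ≤ n · ((n / b) · 2b) · n^(2+ε) ≤ L`.
-/

set_option linter.dupNamespace false

namespace Summit.ValiantsHypothesis.ValiantsHypothesis.Theorems.WordPerSuperQuartic

/-- Natural-number division by `b` loses less than `b`: if `0 < b` and `2b ≤ n` then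
`n ≤ (n / b) · (2b)`. -/
private theorem arith_nat_le_div_mul (n b : ℕ) (hb : 0 < b) (h2b : 2 * b ≤ n) :
    n ≤ n / b * (2 * b) := by
  have hdm : b * (n / b) + n % b = n := Nat.div_add_mod n b
  have hmod : n % b < b := Nat.mod_lt n hb
  set q := n / b with hq
  have hqb : q * (2 * b) = 2 * (b * q) := by ring
  rw [hqb]
  omega

/-- **Final arithmetic.**  From `n · (n / b) · (2b · n^(2+ε)) ≤ L` with `0 < b` and `2b ≤ n`,
conclude `n^(4+ε) ≤ L`. -/
theorem stub_arith (n b L : ℕ) (ε : ℝ) (hb : 0 < b) (h2b : 2 * b ≤ n)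
    (h : (n : ℝ) * (n / b : ℕ) * (2 * (b : ℝ) * (n : ℝ) ^ (2 + ε)) ≤ (L : ℝ)) :
    (n : ℝ) ^ (4 + ε) ≤ (L : ℝ) := by
  have hn : 0 < n := by omega
  have hnR : (0 : ℝ) < (n : ℝ) := by exact_mod_cast hn
  have hle : n ≤ n / b * (2 * b) := arith_nat_le_div_mul n b hb h2b
  have hleR : (n : ℝ) ≤ ((n / b : ℕ) : ℝ) * (2 * (b : ℝ)) := by exact_mod_cast hle
  have hsplit : (n : ℝ) ^ (4 + ε) = (n : ℝ) * (n : ℝ) * (n : ℝ) ^ (2 + ε) := by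
    rw [show (4 + ε : ℝ) = 2 + (2 + ε) by ring, Real.rpow_add hnR, Real.rpow_two]
    ring
  have hpow : (0 : ℝ) ≤ (n : ℝ) ^ (2 + ε) := Real.rpow_nonneg hnR.le _
  calc (n : ℝ) ^ (4 + ε) = (n : ℝ) * (n : ℝ) * (n : ℝ) ^ (2 + ε) := hsplit
    _ ≤ (n : ℝ) * (((n / b : ℕ) : ℝ) * (2 * (b : ℝ))) * (n : ℝ) ^ (2 + ε) := by
        gcongr
    _ = (n : ℝ) * (n / b : ℕ) * (2 * (b : ℝ) * (n : ℝ) ^ (2 + ε)) := by ring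
    _ ≤ (L : ℝ) := h

end Summit.ValiantsHypothesis.ValiantsHypothesis.Theorems.WordPerSuperQuartic
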